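import Summits.QuantumFields.YangMills.Theorems.LuscherReductionTwistedTraceScalingBOCentralGlue
import Summits.QuantumFields.YangMills.Theorems.LuscherReductionTwistedTraceScalingBTFarPairs
import HarnessLib

/-!
# Negative lemma R45 for the crux `TwistedTraceScaling` (stmt-QuantumFields-20203): the pointwise (C1c) hypothesis of the landed (B-OD) glue forces CO-SUPPORT of `G`
# with the gauge-smeared BO function — explicit in-tube configurations where the smeared BO function vanishes while the `G` "of record" is positive

Lane A's glue ✓ `…BOCentralGlue` (`central_transfer_two_sided_of_bricks`) takes, for ONE function `G` on link configurations and constants `0 ≤ mc, Mc`, the POINTWISE brick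
`hC1c : ∀ V, mc·G V ≤ A V ∧ A V ≤ Mc·G V`, where `A V := ∫ W g · boFun χ₀ Ω (V^{g⁻¹}) dg` is the gauge average of the BO function `boFun χ₀ Ω = 𝟙_tube·χ₀(slowMean)·Ω(relLinkVec)`
against the gauge weight `W`, under the support hypotheses `hΩt` (`Ω(linkEmbed v) ≠ 0 ⇒ |v e c| ≤ T`) and `hWc` (`W g ≠ 0 ⇒ ‖q(g_x) − 1‖ ≤ T` for every site), `T ≤ 1/30`.
This file records, sorry-free, what that hypothesis shape costs (all elementary; [folklore]):
* §1 quaternion bookkeeping: dressing a link quotient `P₁P₂⁻¹` by four near-identity gauge factors moves `‖q(·) − 1‖` by at most `4T` (`norm_su2Quat_dressed_quot_sub_one_le`);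
  `‖chartQuat w − 1‖ ≤ 3T` when `|w_c| ≤ T`; `‖chartQuat w − chartQuat(−w)‖ = 2‖w‖`.
* §2 the explicit balanced, capped TWO-LINK fibre vector `v₀ = a·e₀ ⊗ (δ_{(x₁,k)} − δ_{(x₂,k)})` (`x₁ ≠ x₂`, `|a| ≤ 1/2`): `v₀ ∈ capBalancedSet`, so `V₀ := orthoTube u₀ v₀` is a
  tube point with `slowMean V₀ = u₀`, and its link quotient `V₀(x₁,k)·V₀(x₂,k)⁻¹` is at quaternion distance exactly `2|a|` from `1`.
* §3 ★ `smearedBO_twoLink_eq_zero`: under `hΩt` (parameter `T₁`) and the gauge part of `hWc` (parameter `T₂`), `A(V₀) = 0` as soon as `3T₁ + 2T₂ < |a| ≤ 1/2` — for EVERY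
  `u₀`, every `χ₀`, every `x₁ ≠ x₂`, `k`.  Reason: if `W g ≠ 0` and `boFun(V₀^{g⁻¹}) ≠ 0` then `V₀^{g⁻¹} = orthoTube u' v'` with `Ω(v') ≠ 0`, so the same link quotient is within
  `6T₁ + 4T₂ < 2|a|` of `1`.  With the glue's own `T₁ = T₂ = T ≤ 1/30` the window `(5T, 1/2]` is never empty (`smearedBO_twoLink_eq_zero_glue`, `a = 1/2`).
* §4 consequences for (C1c): `hC1c` with `mc > 0` forces `G V₀ ≤ 0` (`G_nonpos_of_hC1c_at`), and with `Mc > 0`, `A ≥ 0` it forces `{G = 0} = {A = 0}` pointwise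
  (`G_eq_zero_iff_of_hC1c_at`); ★★ `not_hC1c_of_slowMean_shape`: NO function of the shape `G V = N·χ₀(slowMean V)·E V` with `N > 0`, `E > 0` and `χ₀ u₀ > 0` for some `u₀`
  (the `G = N̄_W·χ₀(slowMean)·e^{−q(P_⊥ relLinkVec)}` written in lane A's HANDOFF-g16 / COARSE-DESIGN §27.9 is of this shape) satisfies the lower half of `hC1c` with any `mc > 0`
  on a lattice with two distinct sites.  Repair (information for the prover, not a defect of anything landed): `G` must carry a cut-off reproducing the support of `A` — the
  `W`-fattening of the BO support, of fibre radius `O(T)` — and (C1d) must then be proved for THAT `G`; equivalently state (C1c) only on `{A > 0}` and bound `G` there.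
HONEST FRAMING: a constraint on the not-yet-built brick (C1c) of lane A's (OD) chain for a stub of a child of the CONDITIONAL reduction route R2b1; the glue itself is a correct
implication and is not refuted; nothing here is a statement about `TwistedTraceScaling`, infinite volume, a mass gap or the Clay problem.
-/

set_option autoImplicit false

noncomputable section

open MeasureTheory Filter Topology Real
open scoped BigOperators Quaternion
open Literature.MathematicalPhysics.QuantumFieldTheory hiding SU2
open Literature.MathematicalPhysics.QuantumLattice

namespace Summit.QuantumFields.YangMills.Theorems.TwistedTraceScaling.Negative.R45

open Summit.QuantumFields.YangMills.Theorems.FemtoTransferGap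
open Summit.QuantumFields.YangMills.Theorems.FemtoTransferGap.TwoLattice
open Summit.QuantumFields.YangMills.Theorems.FemtoTransferGap.TwoLattice.Avg
open Summit.QuantumFields.YangMills.Theorems.FemtoTransferGap.TwoLattice.ConstTube
open Summit.QuantumFields.YangMills.Theorems.FemtoTransferGap.TwoLattice.Stiff (LinkSpace)
open Literature.MathematicalPhysics.QuantumFieldTheory.Balaban1983to89.T4HaarSU2Translate renaming su2Quat_mul → su2Quat_mul₄, su2Quat_one → su2Quat_one₄

/-! ## §1 Quaternion bookkeeping for near-identity dressings -/

/-- Left multiplication by `A` moves `q` by `‖q(A) − 1‖`. [folklore] -/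
theorem norm_su2Quat_mul_left_sub (A X : SU2) : ‖su2Quat (A * X) - su2Quat X‖ = ‖su2Quat A - 1‖ := by
  rw [su2Quat_mul₄, show su2Quat A * su2Quat X - su2Quat X = (su2Quat A - 1) * su2Quat X by rw [sub_mul, one_mul], norm_mul, norm_su2Quat, mul_one]

/-- Right multiplication by `B` moves `q` by `‖q(B) − 1‖`. [folklore] -/
theorem norm_su2Quat_mul_right_sub (X B : SU2) : ‖su2Quat (X * B) - su2Quat X‖ = ‖su2Quat B - 1‖ := by
  rw [su2Quat_mul₄, show su2Quat X * su2Quat B - su2Quat X = su2Quat X * (su2Quat B - 1) by rw [mul_sub, mul_one], norm_mul, norm_su2Quat, one_mul]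

/-- Inversion preserves the distance to `1`. [folklore] -/
theorem norm_su2Quat_inv_sub_one (B : SU2) : ‖su2Quat B⁻¹ - 1‖ = ‖su2Quat B - 1‖ := by
  have h := norm_su2Quat_mul_inv_sub_one 1 B
  rw [one_mul, su2Quat_one₄] at h
  rw [h, norm_sub_rev]

/-- Inserting a factor `Y` between `P` and `Q` moves `q` by `‖q(Y) − 1‖`. [folklore] -/
theorem norm_su2Quat_insert_sub (P Y Q : SU2) : ‖su2Quat (P * Y * Q) - su2Quat (P * Q)‖ = ‖su2Quat Y - 1‖ := by
  rw [su2Quat_mul₄, su2Quat_mul₄, su2Quat_mul₄,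
    show su2Quat P * su2Quat Y * su2Quat Q - su2Quat P * su2Quat Q = su2Quat P * (su2Quat Y - 1) * su2Quat Q by rw [mul_sub, mul_one, sub_mul],
    norm_mul, norm_mul, norm_su2Quat, norm_su2Quat, one_mul, mul_one]

/-- ★ **Dressing a link quotient by four near-identity gauge factors** moves `‖q(·) − 1‖` by at most `4T`:
`‖q(g₁P₁h₁⁻¹·(g₂P₂h₂⁻¹)⁻¹) − 1‖ ≤ ‖q(P₁P₂⁻¹) − 1‖ + 4T`. [folklore] -/
theorem norm_su2Quat_dressed_quot_sub_one_le {g₁ g₂ h₁ h₂ : SU2} (P₁ P₂ : SU2) {T : ℝ} (hg₁ : ‖su2Quat g₁ - 1‖ ≤ T) (hg₂ : ‖su2Quat g₂ - 1‖ ≤ T)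
    (hh₁ : ‖su2Quat h₁ - 1‖ ≤ T) (hh₂ : ‖su2Quat h₂ - 1‖ ≤ T) :
    ‖su2Quat (g₁ * P₁ * h₁⁻¹ * (g₂ * P₂ * h₂⁻¹)⁻¹) - 1‖ ≤ ‖su2Quat (P₁ * P₂⁻¹) - 1‖ + 4 * T := by
  have hprod : g₁ * P₁ * h₁⁻¹ * (g₂ * P₂ * h₂⁻¹)⁻¹ = g₁ * (P₁ * (h₁⁻¹ * h₂) * P₂⁻¹) * g₂⁻¹ := by group
  rw [hprod]
  set M := P₁ * (h₁⁻¹ * h₂) * P₂⁻¹ with hM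
  have hY : ‖su2Quat (h₁⁻¹ * h₂) - 1‖ ≤ 2 * T := by
    calc ‖su2Quat (h₁⁻¹ * h₂) - 1‖ ≤ ‖su2Quat (h₁⁻¹ * h₂) - su2Quat h₂‖ + ‖su2Quat h₂ - 1‖ := norm_sub_le_norm_sub_add_norm_sub _ _ _
      _ = ‖su2Quat h₁⁻¹ - 1‖ + ‖su2Quat h₂ - 1‖ := by rw [norm_su2Quat_mul_left_sub]
      _ ≤ T + T := by rw [norm_su2Quat_inv_sub_one]; exact add_le_add hh₁ hh₂
      _ = 2 * T := by ring
  have hMq : ‖su2Quat M - su2Quat (P₁ * P₂⁻¹)‖ ≤ 2 * T := by rw [hM, norm_su2Quat_insert_sub]; exact hY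
  have t1 := norm_sub_le_norm_sub_add_norm_sub (su2Quat (g₁ * M * g₂⁻¹)) (su2Quat (g₁ * M)) 1
  have t2 := norm_sub_le_norm_sub_add_norm_sub (su2Quat (g₁ * M)) (su2Quat M) 1
  have t3 := norm_sub_le_norm_sub_add_norm_sub (su2Quat M) (su2Quat (P₁ * P₂⁻¹)) 1
  rw [norm_su2Quat_mul_right_sub, norm_su2Quat_inv_sub_one] at t1
  rw [norm_su2Quat_mul_left_sub] at t2
  linarith

/-- ★ A capped link with components `|w_c| ≤ T` is within `3T` of `1` in the quaternion picture. [folklore] -/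
theorem norm_chartQuat_sub_one_le_of_abs_le {w : Fin 3 → ℝ} (hw : ∑ a, w a ^ 2 ≤ 1) {T : ℝ} (hT : ∀ c, |w c| ≤ T) : ‖chartQuat w - 1‖ ≤ 3 * T := by
  have hT0 : 0 ≤ T := (abs_nonneg _).trans (hT 0)
  have hc : ∀ c, w c ^ 2 ≤ T ^ 2 := fun c => by have h := pow_le_pow_left₀ (abs_nonneg _) (hT c) 2; rwa [sq_abs] at h
  have hs : ∑ a, w a ^ 2 ≤ 3 * T ^ 2 := by
    rw [Fin.sum_univ_three]; linarith [hc 0, hc 1, hc 2]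
  have h := norm_chartQuat_sub_one_sq_le hw
  have h3 : ‖chartQuat w - 1‖ ^ 2 ≤ (3 * T) ^ 2 := by nlinarith
  exact (pow_le_pow_iff_left₀ (norm_nonneg _) (by positivity) two_ne_zero).mp h3

/-- `‖chartQuat w − chartQuat(−w)‖² = 4|w|²` (the real parts cancel, the vector parts double). [folklore] -/
theorem norm_chartQuat_sub_chartQuat_neg_sq (w : Fin 3 → ℝ) : ‖chartQuat w - chartQuat (-w)‖ ^ 2 = 4 * ∑ a, w a ^ 2 := by
  rw [sq, ← Quaternion.normSq_eq_norm_mul_self, Quaternion.normSq_def']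
  simp only [chartQuat, Quaternion.re_sub, Quaternion.imI_sub, Quaternion.imJ_sub, Quaternion.imK_sub, Pi.neg_apply, neg_sq, sub_self, sub_neg_eq_add]
  rw [Fin.sum_univ_three]; ring

/-- The quotient of two links of one tube direction forgets the slow factor: `(chartSU2 w₁·u)(chartSU2 w₂·u)⁻¹ = chartSU2 w₁·(chartSU2 w₂)⁻¹`. [folklore] -/
theorem chart_mul_quot (w₁ w₂ : Fin 3 → ℝ) (u : SU2) : chartSU2 w₁ * u * (chartSU2 w₂ * u)⁻¹ = chartSU2 w₁ * (chartSU2 w₂)⁻¹ := by group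

/-- `‖q(chartSU2 w₁·(chartSU2 w₂)⁻¹) − 1‖ = ‖chartQuat w₁ − chartQuat w₂‖` inside the unit ball. [folklore] -/
theorem norm_su2Quat_chart_quot_sub_one {w₁ w₂ : Fin 3 → ℝ} (h₁ : ∑ a, w₁ a ^ 2 ≤ 1) (h₂ : ∑ a, w₂ a ^ 2 ≤ 1) :
    ‖su2Quat (chartSU2 w₁ * (chartSU2 w₂)⁻¹) - 1‖ = ‖chartQuat w₁ - chartQuat w₂‖ := by
  rw [norm_su2Quat_mul_inv_sub_one, Summit.QuantumFields.YangMills.Theorems.FemtoTransferGap.su2Quat_chartSU2 h₁,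
    Summit.QuantumFields.YangMills.Theorems.FemtoTransferGap.su2Quat_chartSU2 h₂]

/-! ## §2 The explicit two-link fibre vector -/

variable {L : ℕ} [NeZero L]

/-- Column sums of a one-link vector do not depend on the site carrying it. [folklore] -/
theorem sum_single_link_apply (x₀ : Site 3 L) (k k' : Fin 3) (w : Fin 3 → ℝ) (c : Fin 3) :
    ∑ x : Site 3 L, (Pi.single (x₀, k) w : Edge 3 L → Fin 3 → ℝ) (x, k') c = if k' = k then w c else 0 := by
  rw [Finset.sum_eq_single x₀]
  · by_cases hk : k' = k
    · subst hk; rw [if_pos rfl, Pi.single_eq_same]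
    · rw [if_neg hk, Pi.single_eq_of_ne (fun h => hk (congrArg Prod.snd h)), Pi.zero_apply]
  · intro x _ hx; rw [Pi.single_eq_of_ne (fun h => hx (congrArg Prod.fst h)), Pi.zero_apply]
  · intro h; exact absurd (Finset.mem_univ x₀) h

omit [NeZero L] in
/-- Values of the two-link vector `δ_{(x₁,k)}⊗w − δ_{(x₂,k)}⊗w`. [folklore] -/
theorem twoLink_apply {x₁ x₂ : Site 3 L} (hx : x₁ ≠ x₂) (k : Fin 3) (w : Fin 3 → ℝ) (e : Edge 3 L) :
    (Pi.single (x₁, k) w - Pi.single (x₂, k) w : Edge 3 L → Fin 3 → ℝ) e =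
      if e = (x₁, k) then w else if e = (x₂, k) then -w else 0 := by
  have h12 : (x₁, k) ≠ (x₂, k) := fun h => hx (congrArg Prod.fst h)
  rw [Pi.sub_apply]
  by_cases h1 : e = (x₁, k)
  · subst h1; rw [if_pos rfl, Pi.single_eq_same, Pi.single_eq_of_ne h12, sub_zero]
  · rw [if_neg h1, Pi.single_eq_of_ne h1]
    by_cases h2 : e = (x₂, k)
    · subst h2; rw [if_pos rfl, Pi.single_eq_same, zero_sub]
    · rw [if_neg h2, Pi.single_eq_of_ne h2, sub_zero]

omit [NeZero L] in
/-- `Σ_c (±a·e₀)_c² = a²`. [folklore] -/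
theorem sum_sq_single_zero (a : ℝ) : ∑ c : Fin 3, (Pi.single (0 : Fin 3) a : Fin 3 → ℝ) c ^ 2 = a ^ 2 := by
  rw [Fin.sum_univ_three, Pi.single_eq_same, Pi.single_eq_of_ne (by decide : (1 : Fin 3) ≠ 0), Pi.single_eq_of_ne (by decide : (2 : Fin 3) ≠ 0)]; ring

/-- ★ The two-link vector `a·e₀⊗(δ_{(x₁,k)} − δ_{(x₂,k)})`, `x₁ ≠ x₂`, `|a| ≤ 1/2`, is balanced and capped. [folklore] -/
theorem twoLink_mem_capBalancedSet {x₁ x₂ : Site 3 L} (hx : x₁ ≠ x₂) (k : Fin 3) {a : ℝ} (ha : |a| ≤ 1 / 2) :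
    (Pi.single (x₁, k) (Pi.single (0 : Fin 3) a) - Pi.single (x₂, k) (Pi.single (0 : Fin 3) a) : Edge 3 L → Fin 3 → ℝ) ∈ capBalancedSet L := by
  refine ⟨?_, ?_⟩
  · intro k' c
    simp only [Pi.sub_apply, Finset.sum_sub_distrib]
    have h1 := sum_single_link_apply x₁ k k' (Pi.single (0 : Fin 3) a) c
    have h2 := sum_single_link_apply x₂ k k' (Pi.single (0 : Fin 3) a) c
    rw [h1, h2, sub_self]
  · intro e
    rw [twoLink_apply hx]
    have ha2 : a ^ 2 ≤ 1 / 4 := by have h0 := abs_nonneg a; nlinarith [sq_abs a]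
    split_ifs
    · rw [sum_sq_single_zero]; exact ha2
    · simp only [Pi.neg_apply, neg_sq]; rw [sum_sq_single_zero]; exact ha2
    · simp

omit [NeZero L] in
/-- ★ The link quotient of the two-link tube point is at quaternion distance exactly `2|a|` from `1`:
`‖q(V₀(x₁,k)·V₀(x₂,k)⁻¹) − 1‖ = 2|a|` for `V₀ = orthoTube u₀ v₀`. [folklore] -/
theorem norm_su2Quat_twoLink_quot {x₁ x₂ : Site 3 L} (hx : x₁ ≠ x₂) (k : Fin 3) {a : ℝ} (ha : |a| ≤ 1 / 2) (u₀ : GaugeConfig 3 1 SU2) :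
    ‖su2Quat (orthoTube L u₀ (Pi.single (x₁, k) (Pi.single (0 : Fin 3) a) - Pi.single (x₂, k) (Pi.single (0 : Fin 3) a)) (x₁, k) *
        (orthoTube L u₀ (Pi.single (x₁, k) (Pi.single (0 : Fin 3) a) - Pi.single (x₂, k) (Pi.single (0 : Fin 3) a)) (x₂, k))⁻¹) - 1‖ = 2 * |a| := by
  have h12 : (x₂, k) ≠ (x₁, k) := fun h => hx (congrArg Prod.fst h).symm
  rw [orthoTube_apply, orthoTube_apply, twoLink_apply hx, twoLink_apply hx, if_pos rfl, if_neg h12, if_pos rfl, chart_mul_quot]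
  have hw : ∑ c : Fin 3, (Pi.single (0 : Fin 3) a : Fin 3 → ℝ) c ^ 2 ≤ 1 := by
    rw [sum_sq_single_zero]; have h0 := abs_nonneg a; nlinarith [sq_abs a]
  have hw' : ∑ c : Fin 3, (-(Pi.single (0 : Fin 3) a : Fin 3 → ℝ)) c ^ 2 ≤ 1 := by simpa only [Pi.neg_apply, neg_sq] using hw
  rw [norm_su2Quat_chart_quot_sub_one hw hw']
  have hsq : ‖chartQuat (Pi.single (0 : Fin 3) a) - chartQuat (-(Pi.single (0 : Fin 3) a))‖ ^ 2 = (2 * |a|) ^ 2 := by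
    rw [norm_chartQuat_sub_chartQuat_neg_sq, sum_sq_single_zero, mul_pow, sq_abs]; norm_num
  exact (pow_left_inj₀ (norm_nonneg _) (by positivity) two_ne_zero).mp hsq

/-! ## §3 The smeared BO function vanishes at the two-link tube point -/

omit [NeZero L] in
/-- `(V^{g⁻¹})^{g} = V` in the form needed here: if `U' = V^{g⁻¹}` then every link of `V` is the `g`-dressing of the corresponding link of `U'`. [folklore] -/
theorem apply_eq_dress_of_gaugeTransform_inv (g : Site 3 L → SU2) (V U' : GaugeConfig 3 L SU2) (h : U' = gaugeTransform g⁻¹ V) (e : Edge 3 L) :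
    V e = g e.1 * U' e * (g (e.1.shift e.2))⁻¹ := by
  have hg : (fun x => (g⁻¹ x)⁻¹) = g := by funext x; rw [Pi.inv_apply, inv_inv]
  have h2 := gaugeTransform_inv_gaugeTransform g⁻¹ V
  rw [hg] at h2
  have hV : gaugeTransform g U' = V := by rw [h]; exact h2
  rw [← hV]; rfl

/-- ★★ **The smeared BO function vanishes at the two-link tube point.**  Under the support hypotheses of the glue — `Ω(linkEmbed v) ≠ 0 ⇒ |v e c| ≤ T₁` and
`W g ≠ 0 ⇒ ‖q(g_x) − 1‖ ≤ T₂` at every site — the gauge average `∫ W g · boFun χ₀ Ω (V₀^{g⁻¹}) dg` is ZERO at `V₀ = orthoTube u₀ (a·e₀⊗(δ_{(x₁,k)} − δ_{(x₂,k)}))`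
whenever `3T₁ + 2T₂ < |a| ≤ 1/2`: indeed the integrand vanishes identically in `g`. [folklore] -/
theorem smearedBO_twoLink_eq_zero {Ω : LinkSpace L → ℝ} {W : (Site 3 L → SU2) → ℝ} {T₁ T₂ : ℝ}
    (hΩt : ∀ v : Edge 3 L → Fin 3 → ℝ, Ω (linkEmbed L v) ≠ 0 → ∀ e c, |v e c| ≤ T₁) (hWc : ∀ g : Site 3 L → SU2, W g ≠ 0 → ∀ x, ‖su2Quat (g x) - 1‖ ≤ T₂)
    (χ₀ : GaugeConfig 3 1 SU2 → ℝ) (u₀ : GaugeConfig 3 1 SU2) {x₁ x₂ : Site 3 L} (hx : x₁ ≠ x₂) (k : Fin 3) {a : ℝ} (ha : |a| ≤ 1 / 2) (hbig : 3 * T₁ + 2 * T₂ < |a|) :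
    ∫ g, W g * boFun L χ₀ Ω (gaugeTransform g⁻¹ (orthoTube L u₀ (Pi.single (x₁, k) (Pi.single (0 : Fin 3) a) - Pi.single (x₂, k) (Pi.single (0 : Fin 3) a))))
      ∂gaugeMeasure L = 0 := by
  set v₀ : Edge 3 L → Fin 3 → ℝ := Pi.single (x₁, k) (Pi.single (0 : Fin 3) a) - Pi.single (x₂, k) (Pi.single (0 : Fin 3) a) with hv₀
  set V₀ := orthoTube L u₀ v₀ with hV₀
  have hpt : ∀ g : Site 3 L → SU2, W g * boFun L χ₀ Ω (gaugeTransform g⁻¹ V₀) = 0 := by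
    intro g
    by_cases hW : W g = 0
    · rw [hW, zero_mul]
    refine mul_eq_zero_of_right _ ?_
    by_contra hb
    have hmem : gaugeTransform g⁻¹ V₀ ∈ orthoTubeSet L := by
      by_contra hn; exact hb (boFun_eq_zero_of_not_mem L χ₀ Ω hn)
    obtain ⟨u', v', hv', hU'⟩ := hmem
    rw [← hU', boFun_orthoTube L χ₀ Ω u' hv'] at hb
    have hΩ : Ω (linkEmbed L v') ≠ 0 := fun h0 => hb (by rw [h0, mul_zero])
    have hT₁ := hΩt v' hΩ
    have hT₂ := hWc g hW
    have hv1 : ∀ e : Edge 3 L, ∑ c, v' e c ^ 2 ≤ 1 := sum_sq_le_one_of_cap L hv'.2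
    -- the link quotient of `U' = V₀^{g⁻¹}` is within `6T₁` of `1`
    have hU'q : ‖su2Quat (orthoTube L u' v' (x₁, k) * (orthoTube L u' v' (x₂, k))⁻¹) - 1‖ ≤ 6 * T₁ := by
      rw [orthoTube_apply, orthoTube_apply, chart_mul_quot, norm_su2Quat_chart_quot_sub_one (hv1 _) (hv1 _)]
      calc ‖chartQuat (v' (x₁, k)) - chartQuat (v' (x₂, k))‖ ≤ ‖chartQuat (v' (x₁, k)) - 1‖ + ‖1 - chartQuat (v' (x₂, k))‖ := norm_sub_le_norm_sub_add_norm_sub _ _ _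
        _ ≤ 3 * T₁ + 3 * T₁ := by
            rw [norm_sub_rev (1 : ℍ)]
            exact add_le_add (norm_chartQuat_sub_one_le_of_abs_le (hv1 _) (hT₁ _)) (norm_chartQuat_sub_one_le_of_abs_le (hv1 _) (hT₁ _))
        _ = 6 * T₁ := by ring
    -- the same quotient computed from `V₀`: distance exactly `2|a|`, and `V₀` is the `g`-dressing of `U'`
    have hd := fun e => apply_eq_dress_of_gaugeTransform_inv g V₀ (orthoTube L u' v') hU' e
    have hbig' : ‖su2Quat (V₀ (x₁, k) * (V₀ (x₂, k))⁻¹) - 1‖ ≤ 6 * T₁ + 4 * T₂ := by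
      rw [hd (x₁, k), hd (x₂, k)]
      exact (norm_su2Quat_dressed_quot_sub_one_le _ _ (hT₂ _) (hT₂ _) (hT₂ _) (hT₂ _)).trans (by linarith [hU'q])
    rw [hV₀, hv₀, norm_su2Quat_twoLink_quot hx k ha u₀] at hbig'
    linarith
  simp_rw [hpt, integral_zero]

/-- The same statement in the glue's own parameters (`T₁ = T₂ = T ≤ 1/30`) at amplitude `a = 1/2`: the window is never empty. [folklore] -/
theorem smearedBO_twoLink_eq_zero_glue {Ω : LinkSpace L → ℝ} {W : (Site 3 L → SU2) → ℝ} {T : ℝ} (hT : T ≤ 1 / 30)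
    (hΩt : ∀ v : Edge 3 L → Fin 3 → ℝ, Ω (linkEmbed L v) ≠ 0 → ∀ e c, |v e c| ≤ T) (hWc : ∀ g : Site 3 L → SU2, W g ≠ 0 → ∀ x, ‖su2Quat (g x) - 1‖ ≤ T)
    (χ₀ : GaugeConfig 3 1 SU2 → ℝ) (u₀ : GaugeConfig 3 1 SU2) {x₁ x₂ : Site 3 L} (hx : x₁ ≠ x₂) (k : Fin 3) :
    ∫ g, W g * boFun L χ₀ Ω (gaugeTransform g⁻¹ (orthoTube L u₀
        (Pi.single (x₁, k) (Pi.single (0 : Fin 3) (1 / 2)) - Pi.single (x₂, k) (Pi.single (0 : Fin 3) (1 / 2))))) ∂gaugeMeasure L = 0 :=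
  smearedBO_twoLink_eq_zero hΩt hWc χ₀ u₀ hx k (by norm_num) (by rw [abs_of_pos (by norm_num : (0 : ℝ) < 1 / 2)]; linarith)

/-! ## §4 Consequences for the pointwise brick (C1c) -/

omit [NeZero L] in
/-- The lower half of (C1c) at a point where the smeared BO function vanishes forces `G ≤ 0` there (`mc > 0`). [folklore] -/
theorem G_nonpos_of_hC1c_at {A G mc : ℝ} (hmc : 0 < mc) (hl : mc * G ≤ A) (hA : A = 0) : G ≤ 0 := by
  by_contra hG
  exact absurd hl (not_le.mpr (by rw [hA]; exact mul_pos hmc (not_le.mp hG)))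

omit [NeZero L] in
/-- ★ **Co-support**: the two-sided pointwise comparison `mc·G ≤ A ≤ Mc·G` with `mc, Mc > 0` and `A ≥ 0` forces `G ≥ 0` and `{G = 0} = {A = 0}`. [folklore] -/
theorem G_eq_zero_iff_of_hC1c_at {A G mc Mc : ℝ} (hmc : 0 < mc) (hMc : 0 < Mc) (hA0 : 0 ≤ A) (hl : mc * G ≤ A) (hu : A ≤ Mc * G) :
    0 ≤ G ∧ (G = 0 ↔ A = 0) := by
  have hG0 : 0 ≤ G := le_of_mul_le_mul_left (by rw [mul_zero]; exact hA0.trans hu) hMc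
  refine ⟨hG0, fun hG => le_antisymm (by rw [hG, mul_zero] at hu; exact hu) hA0, fun hA => le_antisymm (G_nonpos_of_hC1c_at hmc hl hA) hG0⟩

/-- ★★ **No `G` of the shape `N·χ₀(slowMean V)·E(V)` with `N > 0`, `E > 0` satisfies the lower half of (C1c) with `mc > 0`** (given two distinct sites, the glue's support
hypotheses with `3T₁ + 2T₂ < 1/2`, and one `u₀` with `χ₀ u₀ > 0`): at the two-link tube point over `u₀` the smeared BO function is `0` while `G > 0`. [folklore] -/
theorem not_hC1c_of_slowMean_shape {Ω : LinkSpace L → ℝ} {W : (Site 3 L → SU2) → ℝ} {T₁ T₂ : ℝ}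
    (hΩt : ∀ v : Edge 3 L → Fin 3 → ℝ, Ω (linkEmbed L v) ≠ 0 → ∀ e c, |v e c| ≤ T₁) (hWc : ∀ g : Site 3 L → SU2, W g ≠ 0 → ∀ x, ‖su2Quat (g x) - 1‖ ≤ T₂)
    (hT : 3 * T₁ + 2 * T₂ < 1 / 2) {χ₀ : GaugeConfig 3 1 SU2 → ℝ} {u₀ : GaugeConfig 3 1 SU2} (hχ₀ : 0 < χ₀ u₀) {x₁ x₂ : Site 3 L} (hx : x₁ ≠ x₂)
    {G E : GaugeConfig 3 L SU2 → ℝ} {N : ℝ} (hG : ∀ V, G V = N * χ₀ (slowMean L V) * E V) (hN : 0 < N) (hE : ∀ V, 0 < E V) {mc : ℝ} (hmc : 0 < mc)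
    (hC1c : ∀ V : GaugeConfig 3 L SU2, mc * G V ≤ ∫ g, W g * boFun L χ₀ Ω (gaugeTransform g⁻¹ V) ∂gaugeMeasure L) : False := by
  have ha : |(1 / 2 : ℝ)| ≤ 1 / 2 := by rw [abs_of_pos (by norm_num : (0 : ℝ) < 1 / 2)]
  have hbig : 3 * T₁ + 2 * T₂ < |(1 / 2 : ℝ)| := by rwa [abs_of_pos (by norm_num : (0 : ℝ) < 1 / 2)]
  set v₀ : Edge 3 L → Fin 3 → ℝ := Pi.single (x₁, (0 : Fin 3)) (Pi.single (0 : Fin 3) (1 / 2 : ℝ)) - Pi.single (x₂, (0 : Fin 3)) (Pi.single (0 : Fin 3) (1 / 2 : ℝ))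
    with hv₀
  have hv₀m : v₀ ∈ capBalancedSet L := twoLink_mem_capBalancedSet hx 0 ha
  have hA : ∫ g, W g * boFun L χ₀ Ω (gaugeTransform g⁻¹ (orthoTube L u₀ v₀)) ∂gaugeMeasure L = 0 := smearedBO_twoLink_eq_zero hΩt hWc χ₀ u₀ hx 0 ha hbig
  have hle : G (orthoTube L u₀ v₀) ≤ 0 := G_nonpos_of_hC1c_at hmc (hC1c _) hA
  have hpos : 0 < G (orthoTube L u₀ v₀) := by
    rw [hG, slowMean_orthoTube L u₀ hv₀m]; exact mul_pos (mul_pos hN hχ₀) (hE _)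
  exact absurd hle (not_le.mpr hpos)

end Summit.QuantumFields.YangMills.Theorems.TwistedTraceScaling.Negative.R45

end
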